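import Summits.Parity.GeneralizedHardyLittlewood.Theses.LiouvilleMAD
import Literature.NumberTheory.Sieve.HardyLittlewoodChowla

/-!
# `LambdaLiouvilleLevel` (stmt-Parity-13325): the `q = 1` face is quantitative hybrid
# Hardy–Littlewood–Chowla with `k = ℓ = 1`

HARDNESS CALIBRATION for the crux
`Summit.Parity.GeneralizedHardyLittlewood.Theses.LiouvilleMAD.LambdaLiouvilleLevel`
(Bombieri–Vinogradov at level `N^{ε₀}` for the sequence `Λ(n)λ(n+h)`), kernel-checking what the
item's docstring and the grounders assert informally:

* `hlcFace_of_lambdaLiouvilleLevel` — the crux implies, for every shift `h ≥ 1` and every `A > 0`,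
  `|∑_{1 ≤ n ≤ N} Λ(n) λ(n+h)| ≤ C·N/(log N)^A` for `N ≥ N₀`, i.e. a log-power-saving bound for the
  Literature object `Literature.NumberTheory.Sieve.hlcLiouvilleSum {0} {h}` (the `q = 1`, `w = 0`,
  `y = N` specialisation of the crux; `hlcLiouvilleSum_zero_singleton`);
* `hlc_one_one_of_lambdaLiouvilleLevel` — hence `∑_{n ≤ N} Λ(n) λ(n+h) = o(N)` for every `h ≥ 1`:
  the `k = ℓ = 1` case of the hybrid Hardy–Littlewood–Chowla conjecture in Liouville form
  (Lichtman–Teräväinen 2022, Conjecture 1.1; Tao–Teräväinen 2022, Conjecture 1.3), which is OPEN —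
  print proves only averages over the shift (`lichtmanTeravainen2022_hlc_avg_liouville`).

So every proof of the crux proves an open conjecture already at `q = 1`; conversely the tree has
`Theorems.TypeIIToLevel.TypeIIToLevel_proof : TypeIILiouville → LambdaLiouvilleLevel`, so the crux
sits between the open crux `TypeIILiouville` (stmt-Parity-13322) and open hybrid HLC(1,1).
Depth, not falsity. [folklore]
-/

namespace Summit.Parity.GeneralizedHardyLittlewood.Theorems.LambdaLiouvilleLevel.Negative

open Finset Filter Asymptotics
open Summit.Parity.GeneralizedHardyLittlewood.Theses.LiouvilleMAD (LambdaLiouvilleLevel)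
open Literature.NumberTheory.Sieve (hlcLiouvilleSum hlcLiouvilleSum_zero_singleton)

/-- The `q = 1` term of the crux's modulus sum, at residue `0` and height `N`, is the two-point sum
`∑_{1 ≤ n ≤ N} Λ(n) λ(n+h)` = `hlcLiouvilleSum {0} {h} N` (for a natural-number shift `h`). [folklore] -/
theorem qOneTerm_eq_hlcLiouvilleSum (h N : ℕ) :
    (∑ n ∈ (Icc 1 N).filter (fun n : ℕ => n ≡ 0 [MOD 1]),
        ArithmeticFunction.vonMangoldt n *
          (ArithmeticFunction.liouville (Int.toNat ((n : ℤ) + (h : ℕ))) : ℝ)) =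
      hlcLiouvilleSum {0} {h} N := by
  rw [hlcLiouvilleSum_zero_singleton]
  have hfilter : (Icc 1 N).filter (fun n : ℕ => n ≡ 0 [MOD 1]) = Icc 1 N :=
    Finset.filter_true_of_mem (fun n _ => Nat.modEq_one)
  rw [hfilter]
  refine Finset.sum_congr rfl (fun n _ => ?_)
  have hcast : ((n : ℤ) + ((h : ℕ) : ℤ)) = ((n + h : ℕ) : ℤ) := by push_cast; ring
  rw [hcast, Int.toNat_natCast]

/-- **Hardness calibration (`q = 1` face).** `LambdaLiouvilleLevel` implies, for every shift
`h ≥ 1` and every `A > 0`, the log-power-saving two-point bound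
`|∑_{1 ≤ n ≤ N} Λ(n) λ(n+h)| ≤ C·N/(log N)^A` for all `N ≥ N₀` — a quantitative form of the
`k = ℓ = 1` case of the hybrid Hardy–Littlewood–Chowla conjecture (open; Lichtman–Teräväinen 2022
Conj. 1.1 asks only `o(N)`). Proof: specialise the crux to `w ≡ 0`, `y ≡ N` and keep the `q = 1`
term of the sum of absolute values. [folklore] -/
theorem hlcFace_of_lambdaLiouvilleLevel (hL : LambdaLiouvilleLevel) (h : ℕ) (hh : 1 ≤ h)
    (A : ℝ) (hA : 0 < A) :
    ∃ C : ℝ, ∃ N₀ : ℕ, ∀ N : ℕ, N₀ ≤ N →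
      |hlcLiouvilleSum {0} {h} N| ≤ C * N / Real.log N ^ A := by
  have hh0 : (h : ℤ) ≠ 0 := by exact_mod_cast Nat.one_le_iff_ne_zero.mp hh
  obtain ⟨ε₀, hε₀, hAll⟩ := hL (h : ℤ) hh0
  obtain ⟨C, N₀, hN⟩ := hAll A hA
  refine ⟨C, max N₀ 1, fun N hN0 => ?_⟩
  have hN₀ : N₀ ≤ N := le_trans (le_max_left _ _) hN0
  have hN1 : 1 ≤ N := le_trans (le_max_right _ _) hN0
  have key := hN N hN₀ (fun _ => 0) (fun _ => N) (fun _ => le_rfl)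
  have h1mem : 1 ∈ Icc 1 ⌊(N : ℝ) ^ ε₀⌋₊ := by
    rw [mem_Icc]
    refine ⟨le_rfl, Nat.le_floor ?_⟩
    rw [Nat.cast_one]
    exact Real.one_le_rpow (by exact_mod_cast hN1) hε₀.le
  have hle := Finset.single_le_sum
    (f := fun q => |∑ n ∈ (Icc 1 N).filter (fun n : ℕ => n ≡ 0 [MOD q]),
      ArithmeticFunction.vonMangoldt n *
        (ArithmeticFunction.liouville (Int.toNat ((n : ℤ) + (h : ℕ))) : ℝ)|)
    (fun q _ => abs_nonneg _) h1mem
  rw [qOneTerm_eq_hlcLiouvilleSum] at hle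
  exact hle.trans key

/-- **The crux proves hybrid Hardy–Littlewood–Chowla, case `k = ℓ = 1` (Liouville form).**
`LambdaLiouvilleLevel` implies `∑_{1 ≤ n ≤ N} Λ(n) λ(n+h) = o(N)` for every shift `h ≥ 1` — the
statement of Lichtman–Teräväinen 2022 Conjecture 1.1 / Tao–Teräväinen 2022 Conjecture 1.3 with one
von Mangoldt and one Liouville factor (singular series `0`), OPEN in print (only the `k + ℓ ≤ 1`
cases and averages over the shift are known). From `hlcFace_of_lambdaLiouvilleLevel` with `A = 1`
and `log N → ∞`. [folklore] -/
theorem hlc_one_one_of_lambdaLiouvilleLevel (hL : LambdaLiouvilleLevel) (h : ℕ) (hh : 1 ≤ h) :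
    (fun N : ℕ => hlcLiouvilleSum {0} {h} N) =o[atTop] fun N : ℕ => (N : ℝ) := by
  obtain ⟨C, N₀, hN⟩ := hlcFace_of_lambdaLiouvilleLevel hL h hh 1 one_pos
  rw [Asymptotics.isLittleO_iff]
  intro c hc
  set L : ℝ := max C 0 / c + 1 with hL_def
  have hL0 : 0 < L := by
    have : 0 ≤ max C 0 / c := div_nonneg (le_max_right _ _) hc.le
    linarith
  have hCL : max C 0 / L ≤ c := by
    rw [div_le_iff₀ hL0]
    have h1 : max C 0 = (max C 0 / c) * c := by field_simp
    have h2 : 0 ≤ max C 0 / c := div_nonneg (le_max_right _ _) hc.le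
    nlinarith [le_max_right C 0]
  have hlog : Tendsto (fun N : ℕ => Real.log (N : ℝ)) atTop atTop :=
    Real.tendsto_log_atTop.comp tendsto_natCast_atTop_atTop
  filter_upwards [eventually_ge_atTop N₀, hlog.eventually_ge_atTop L] with N hN₀ hNL
  have hlogpos : 0 < Real.log (N : ℝ) := lt_of_lt_of_le hL0 hNL
  have hNn : 0 ≤ (N : ℝ) := Nat.cast_nonneg N
  have hb := hN N hN₀
  rw [Real.rpow_one] at hb
  rw [Real.norm_eq_abs, Real.norm_eq_abs, abs_of_nonneg hNn]
  calc |hlcLiouvilleSum {0} {h} N| ≤ C * N / Real.log N := hb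
    _ ≤ max C 0 * N / Real.log N := by
        gcongr
        exact le_max_left _ _
    _ ≤ max C 0 * N / L := by
        have : 0 ≤ max C 0 * N := mul_nonneg (le_max_right _ _) hNn
        exact div_le_div_of_nonneg_left this hL0 hNL
    _ = (max C 0 / L) * N := by ring
    _ ≤ c * N := by gcongr

end Summit.Parity.GeneralizedHardyLittlewood.Theorems.LambdaLiouvilleLevel.Negative
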